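import Summits.QuantumFields.YangMills.Theorems.BalabanUVNodesPortS1TracePowWalks
import Literature.MathematicalPhysics.QuantumFieldTheory.Balaban1983to89.TreeLengthTorusTransfer

/-!
# NODE O port PT-A — THE (R-c) LEAF, WALK-SUM EDITION, PART A (algebra; director-ym №548 GO): the power members `Tr Tᵐ` of [16] (63) for an operator given as a SUM OF LOCALIZED PIECES
# `T = Σ_{Y ∈ 𝐃} T_Y` (the (P4) shape of the P0-ℂ letter: `T_Y` supported on the indices whose cubes lie in the torus localization domain `Y`) — `Tr Tᵐ = Σ_{X} locPowPiece supp T m X`,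
# the piece of `X` collecting the m-tuples of pieces that CHAIN (consecutive supports meet) with union EXACTLY `X`; non-chaining tuples vanish; `|Tr Π T_{Yᵢ}| ≤ N_X · Π ‖T_{Yᵢ}‖`

Cell `ym-nodeO-ideate`, porter seat `ymgap-nodeO-port-PTA-1` (gen 7, lead of the line `pta-residueW` of 27930's skeleton v3.2); `--supports stmt-QuantumFields-27930` (helper).
[16] = [Balaban1985UV3] (63) p.272; [II] = [Balaban1988RG2Cluster] (2.27) p.18; [I] = [Balaban1987RG1] (1.7), (1.18).

WHY.  Skeleton v3.3 (★★★ №548) = {`stub_P0C` (P1)–(P5), `stub_G3C` (P6), `stub_FE`} + the porter glue `lzdetHalf_of_P0C_G3C`, which packages `−½[log det T(B) − log det T(0)]` by (63):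
`−½ log det T = ½∫₀^R Tr(T + x)⁻¹ dx − ½ log R · Tr 1 + Σ_{m ≥ 1} ((−1)ᵐ∕2m) R⁻ᵐ Tr Tᵐ` (✓ `B10LogDet63.matrix63`, any `R` above the spectrum).  The resolvent member is localized by the walk
leaves (P6); the POWER members must be localized from the letter's clause (P4) ALONE — `T = Σ_Y T_Y`, `T_Y` supported in `Y`, `‖T_Y‖ ≤ c₀ e^{−δ₀ d(Y)}` — with NO random walk: expand
`Tr (Σ_Y T_Y)ᵐ = Σ_{(Y₁,…,Y_m)} Tr (T_{Y₁} ⋯ T_{Y_m})`, note that a tuple contributes only if consecutive supports MEET (else the product is `0`), so its union is face-connected — a localization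
domain `X` — and attach the tuple to that `X`.  THIS FILE is the algebra of that expansion (PART B, the polymer bound `Σ_{tuples ↦ X} Π c₀e^{−δ₀ d(Yᵢ)} ≤ B·|X|·Kᵐ·e^{−r d(X)}` via ✓ [II] (2.27)
`torusTreeLen_biUnion_add_two_le` and the `K₀`-sums of `B12TreeDecay`, is the companion to come; with `R` chosen above `2·c₀·K` the power series of pieces converges geometrically — the glue's
choice).  Vocabulary: torus cubes `TPt d N`, domains `TDom d N` (`TreeLengthTorus`), the site lists `listsLen` of ✓p819120 `…TracePowWalks`, a cube map `cube : S → TPt d N` on the matrix indices.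
* §1 `sum_pow_eq_sum_listsLen` — the non-commutative multinomial `(Σ_i a i)ᵐ = Σ_{|l| = m} (l.map a).prod` (any ring, any finite index type).
* §2 supports (entries vanish unless both indices have their cube in `Y`, stated as explicit hypotheses): `mul_supported`, ★ `mul_eq_zero_of_disjoint_support`, `supported_prod_map`, ★ `prod_map_eq_zero_of_not_isChain`.
* §3 `tFaceConnected_union`, ★ `isTDom_union_of_isChain` (the union of the supports along a chaining non-empty list is a domain when the supports are).
* §4 `norm_entry_le_opNorm` (any finite index type), ★ `norm_trace_le_of_supported` (`‖Tr A‖ ≤ #{s : cube s ∈ X}·‖A‖`), `norm_prod_map_le`.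
* §5 `locPowPiece supp T m U` (pieces `T i` with supports `supp i`, any finite index), ★★ `trace_pow_eq_sum_locPowPiece` (`Tr (Σ_i T_i)ᵐ = Σ_U locPowPiece supp T m U`, all `m`), ★ `norm_locPowPiece_le`
  (`≤ N_U · Σ_{chains ↦ U} Π ‖T_i‖`); §6 ★ `locPowPiece_eq_zero_of_not_isTDom` (on the torus only localization domains carry pieces).

HONEST FRAMING.  Finite non-commutative algebra, supports and a trace bound ([folklore]; the (63)∕(2.27) cites are locators); NOTHING of Bałaban's estimates asserted, ported or discharged; the letter
(P1)–(P5), the leaves (P6) and the glue are NOT here; `stub_LZdet` ⊃ P0-ℂ and `stub_FE` OPEN; 27930 ⁸-Ax-LR4 OPEN · 2∕4 stubs · no claim; NODE O 0∕1; COUNT 8∕28 · K 1∕4 UNMOVED; finite `𝕋⁴_{L^K}`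
at fixed ε — NOT continuum ∕ OS ∕ Clay; **the Yang–Mills mass gap is NOT proved by any of this.**  No `sorry`, no `instance`, no `notation`; one small `def` (`locPowPiece`); standard axioms.
-/

open scoped BigOperators Matrix.Norms.L2Operator
open Finset

namespace Summit.QuantumFields.YangMills.Theorems.BalabanUVNodesPortS1

open Literature.MathematicalPhysics.QuantumFieldTheory.Balaban1983to89
open Literature.MathematicalPhysics.QuantumFieldTheory.Balaban1983to89.TreeLengthTorus (TPt TDom IsTDom TFaceConnected TLinked)
open Literature.MathematicalPhysics.QuantumFieldTheory.Balaban1983to89.TreeLengthTorusTransfer (tLinked_mono tLinked_trans)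

/-! ## §1  The non-commutative multinomial over site lists -/

section Multinomial

variable {ι : Type} [Fintype ι] [DecidableEq ι] {R : Type*} [Ring R]

/-- **`(Σ_i a i)ᵐ = Σ_{|l| = m} a(l₀)·a(l₁)⋯`** (non-commutative; the lists of ✓ `listsLen`). [folklore] -/
theorem sum_pow_eq_sum_listsLen (a : ι → R) : ∀ m : ℕ, (∑ i, a i) ^ m = ∑ l ∈ listsLen (S := ι) m, (l.map a).prod
  | 0 => by simp [listsLen]
  | m + 1 => by
    have h := sum_pow_eq_sum_listsLen a m
    rw [pow_succ', h, sum_mul]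
    have hsplit : ∑ l ∈ listsLen (S := ι) (m + 1), (l.map a).prod = ∑ s : ι, ∑ l ∈ listsLen (S := ι) m, ((s :: l).map a).prod := by
      show ∑ l ∈ Finset.univ.biUnion (fun s : ι => (listsLen m).image (List.cons s)), (l.map a).prod = _
      rw [sum_biUnion (fun s hs s' hs' hss' => pairwiseDisjoint_image_cons (listsLen m) (Set.mem_univ s) (Set.mem_univ s') hss')]
      refine sum_congr rfl fun s _ => ?_
      rw [sum_image fun l _ l' _ hl => (List.cons.inj hl).2]
    rw [hsplit]
    refine sum_congr rfl fun s _ => ?_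
    rw [mul_sum]
    refine sum_congr rfl fun l _ => ?_
    rw [List.map_cons, List.prod_cons]

end Multinomial

/-! ## §2  Supports: pieces living on a cube set, products of disjointly supported pieces vanish -/

section Support

variable {S : Type} [Fintype S] [DecidableEq S] {Q : Type} {cube : S → Q} {ι : Type*}

omit [DecidableEq S] in
/-- A product of a piece supported in `Y` (entries vanish unless both indices have their cube in `Y` — the shape of the letter's clause (P4)) and a piece supported in `Y'` is supported in `Y ∪ Y'`.
[cite: Balaban1987RG1, (1.7) p.261 (bookkeeping)] -/
theorem mul_supported [DecidableEq Q] {Y Y' : Finset Q} {A B : Matrix S S ℂ} (hA : ∀ s s', (cube s ∉ Y ∨ cube s' ∉ Y) → A s s' = 0)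
    (hB : ∀ s s', (cube s ∉ Y' ∨ cube s' ∉ Y') → B s s' = 0) :
    ∀ s s', (cube s ∉ Y ∪ Y' ∨ cube s' ∉ Y ∪ Y') → (A * B) s s' = 0 := by
  intro s s' hs
  rw [Matrix.mul_apply]
  refine sum_eq_zero fun t _ => ?_
  rcases hs with h | h
  · rw [hA s t (Or.inl fun h' => h (mem_union_left _ h')), zero_mul]
  · rw [hB t s' (Or.inr fun h' => h (mem_union_right _ h')), mul_zero]

omit [DecidableEq S] in
/-- ★ **PIECES WITH DISJOINT SUPPORTS MULTIPLY TO ZERO**: the middle index would have to lie in both. [folklore] -/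
theorem mul_eq_zero_of_disjoint_support {Y Y' : Finset Q} {A B : Matrix S S ℂ} (hA : ∀ s s', (cube s ∉ Y ∨ cube s' ∉ Y) → A s s' = 0)
    (hB : ∀ s s', (cube s ∉ Y' ∨ cube s' ∉ Y') → B s s' = 0) (h : Disjoint Y Y') : A * B = 0 := by
  ext s s'
  rw [Matrix.mul_apply, Matrix.zero_apply]
  refine sum_eq_zero fun t _ => ?_
  by_cases ht : cube t ∈ Y
  · rw [hB t s' (Or.inl (Finset.disjoint_left.1 h ht)), mul_zero]
  · rw [hA s t (Or.inr ht), zero_mul]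

/-- The product of a NON-EMPTY list of supported pieces is supported in the union of the supports (pieces `T i` with supports `supp i`). [folklore] -/
theorem supported_prod_map [DecidableEq Q] (supp : ι → Finset Q) (T : ι → Matrix S S ℂ) (hT : ∀ i s s', (cube s ∉ supp i ∨ cube s' ∉ supp i) → T i s s' = 0) :
    ∀ l : List ι, l ≠ [] → ∀ s s', (cube s ∉ (l.map supp).foldr (· ∪ ·) ∅ ∨ cube s' ∉ (l.map supp).foldr (· ∪ ·) ∅) → (l.map T).prod s s' = 0
  | [], h => (h rfl).elim
  | [i], _ => by simpa using hT i
  | i :: j :: l, _ => by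
    show ∀ s s', (cube s ∉ supp i ∪ ((j :: l).map supp).foldr (· ∪ ·) ∅ ∨ cube s' ∉ supp i ∪ ((j :: l).map supp).foldr (· ∪ ·) ∅) →
      (T i * ((j :: l).map T).prod) s s' = 0
    exact mul_supported (hT i) (supported_prod_map supp T hT (j :: l) (List.cons_ne_nil _ _))

/-- ★ **A TUPLE THAT DOES NOT CHAIN VANISHES**: if some two consecutive supports are disjoint, the ordered product of the pieces is `0`. [folklore] -/
theorem prod_map_eq_zero_of_not_isChain (supp : ι → Finset Q) (T : ι → Matrix S S ℂ) (hT : ∀ i s s', (cube s ∉ supp i ∨ cube s' ∉ supp i) → T i s s' = 0) :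
    ∀ l : List ι, ¬ List.IsChain (fun i j => ¬ Disjoint (supp i) (supp j)) l → (l.map T).prod = 0
  | [], h => (h List.isChain_nil).elim
  | [i], h => (h (List.isChain_singleton i)).elim
  | i :: j :: l, h => by
    rw [List.map_cons, List.map_cons, List.prod_cons, List.prod_cons]
    by_cases hd : Disjoint (supp i) (supp j)
    · rw [← mul_assoc, mul_eq_zero_of_disjoint_support (hT i) (hT j) hd, zero_mul]
    · have h' : ¬ List.IsChain (fun i j => ¬ Disjoint (supp i) (supp j)) (j :: l) := fun hc => h (List.isChain_cons_cons.2 ⟨hd, hc⟩)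
      have := prod_map_eq_zero_of_not_isChain supp T hT (j :: l) h'
      rw [List.map_cons, List.prod_cons] at this
      rw [this, mul_zero]

end Support

/-! ## §3  The union of a chaining list of torus localization domains is a localization domain -/

section Union

variable {d N : ℕ}

/-- Two face-connected cube families with a common cube have a face-connected union. [cite: Balaban1987RG1, p.257 («connected family»); Balaban1988RG2Cluster, (2.27) p.18] -/
theorem tFaceConnected_union {A B : Finset (TPt d N)} (hA : TFaceConnected A) (hB : TFaceConnected B) (hAB : ¬ Disjoint A B) :
    TFaceConnected (A ∪ B) := by
  obtain ⟨z, hzA, hzB⟩ := Finset.not_disjoint_iff.1 hAB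
  have hA' : ∀ x ∈ A, TLinked (A ∪ B) x z := fun x hx => tLinked_mono subset_union_left (hA x hx z hzA)
  have hB' : ∀ y ∈ B, TLinked (A ∪ B) z y := fun y hy => tLinked_mono subset_union_right (hB z hzB y hy)
  have hB'' : ∀ y ∈ B, TLinked (A ∪ B) y z := fun y hy => tLinked_mono subset_union_right (hB y hy z hzB)
  have hA'' : ∀ x ∈ A, TLinked (A ∪ B) z x := fun x hx => tLinked_mono subset_union_left (hA z hzA x hx)
  intro x hx y hy
  rcases Finset.mem_union.1 hx with hx | hx <;> rcases Finset.mem_union.1 hy with hy | hy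
  · exact tLinked_trans (hA' x hx) (hA'' y hy)
  · exact tLinked_trans (hA' x hx) (hB' y hy)
  · exact tLinked_trans (hB'' x hx) (hA'' y hy)
  · exact tLinked_trans (hB'' x hx) (hB' y hy)

/-- ★ **THE UNION OF A CHAINING NON-EMPTY LIST OF DOMAINS IS A DOMAIN** (non-empty, face-connected): for supports `supp i` that are torus localization domains and a list along which consecutive
supports meet. [cite: Balaban1988RG2Cluster, (2.27) p.18 («⋃ Y = Y₀ … a connected domain»)] -/
theorem isTDom_union_of_isChain {ι : Type*} (supp : ι → Finset (TPt d N)) (hsupp : ∀ i, IsTDom (supp i)) :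
    ∀ l : List ι, l ≠ [] → List.IsChain (fun i j => ¬ Disjoint (supp i) (supp j)) l → IsTDom ((l.map supp).foldr (· ∪ ·) ∅)
  | [], h, _ => (h rfl).elim
  | [i], _, _ => by simpa using hsupp i
  | i :: j :: l, _, hc => by
    obtain ⟨hij, hc'⟩ := List.isChain_cons_cons.1 hc
    have ih := isTDom_union_of_isChain supp hsupp (j :: l) (List.cons_ne_nil _ _) hc'
    rw [List.map_cons, List.foldr_cons]
    refine ⟨(hsupp i).1.mono subset_union_left, tFaceConnected_union (hsupp i).2 ih.2 fun hdis => hij (hdis.mono_right ?_)⟩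
    rw [List.map_cons, List.foldr_cons]
    exact subset_union_left

end Union

/-! ## §4  The trace of a supported matrix against the operator norm -/

section Trace

variable {S : Type} [Fintype S] [DecidableEq S]

/-- Every entry is bounded by the operator norm: `|A a b| ≤ ‖A‖` (PTZ-1's `norm_entry_le_norm`, any finite index type). [folklore] -/
theorem norm_entry_le_opNorm (Y : Matrix S S ℂ) (a b : S) : ‖Y a b‖ ≤ ‖Y‖ := by
  have h := Matrix.l2_opNorm_mulVec Y (EuclideanSpace.single b (1 : ℂ))
  rw [PiLp.norm_single, norm_one, mul_one] at h
  refine le_trans ?_ h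
  have hs : (⇑(EuclideanSpace.single b (1 : ℂ)) : S → ℂ) = Pi.single b 1 :=
    funext fun k => by simp [Pi.single_apply, eq_comm]
  have h2 := PiLp.norm_apply_le ((EuclideanSpace.equiv S ℂ).symm (Y.mulVec ⇑(EuclideanSpace.single b (1 : ℂ)))) a
  have h3 : ((EuclideanSpace.equiv S ℂ).symm (Y.mulVec ⇑(EuclideanSpace.single b (1 : ℂ)))) a = Y a b := by
    rw [hs, Matrix.mulVec_single_one]
    rfl
  rwa [h3] at h2

variable {Q : Type} [DecidableEq Q] {cube : S → Q}

/-- ★ **THE TRACE OF A PIECE SUPPORTED IN `X`**: `‖Tr A‖ ≤ #{s : cube s ∈ X} · ‖A‖` (only the diagonal entries over `X` survive; each is `≤ ‖A‖`).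
[cite: Balaban1985UV3, (23) p.262 (the volume factor of a localized term)] -/
theorem norm_trace_le_of_supported {X : Finset Q} {A : Matrix S S ℂ} (hA : ∀ s s', (cube s ∉ X ∨ cube s' ∉ X) → A s s' = 0) :
    ‖Matrix.trace A‖ ≤ ((univ.filter fun s : S => cube s ∈ X).card : ℝ) * ‖A‖ := by
  have htr : Matrix.trace A = ∑ s ∈ univ.filter (fun s : S => cube s ∈ X), A s s := by
    rw [Matrix.trace, ← sum_filter_add_sum_filter_not univ (fun s : S => cube s ∈ X)]
    simp only [Matrix.diag_apply]
    rw [sum_eq_zero (s := univ.filter fun s : S => ¬ cube s ∈ X) (fun s hs => hA s s (Or.inl (mem_filter.1 hs).2)), add_zero]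
  rw [htr]
  refine (norm_sum_le _ _).trans ?_
  calc ∑ s ∈ univ.filter (fun s : S => cube s ∈ X), ‖A s s‖ ≤ ∑ _s ∈ univ.filter (fun s : S => cube s ∈ X), ‖A‖ :=
        sum_le_sum fun s _ => norm_entry_le_opNorm A s s
    _ = _ := by rw [sum_const, nsmul_eq_mul]

/-- `‖(l.map T).prod‖ ≤ (l.map (‖T ·‖)).prod` for a non-empty list (submultiplicativity). [folklore] -/
theorem norm_prod_map_le {ι : Type*} (T : ι → Matrix S S ℂ) : ∀ l : List ι, l ≠ [] → ‖(l.map T).prod‖ ≤ (l.map fun Y => ‖T Y‖).prod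
  | [], h => (h rfl).elim
  | [Y], _ => by simp
  | Y :: Y' :: l, _ => by
    rw [List.map_cons, List.prod_cons, List.map_cons, List.prod_cons]
    exact (norm_mul_le _ _).trans (mul_le_mul_of_nonneg_left (norm_prod_map_le T (Y' :: l) (List.cons_ne_nil _ _)) (norm_nonneg _))

end Trace

/-! ## §5  ★★ The localized power expansion: `Tr (Σ_i T_i)ᵐ = Σ_U locPowPiece supp T m U` -/

section Regroup

variable {S : Type} [Fintype S] [DecidableEq S] {Q : Type} [Fintype Q] [DecidableEq Q] {cube : S → Q}
  {ι : Type} [Fintype ι] [DecidableEq ι] (supp : ι → Finset Q) (T : ι → Matrix S S ℂ)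

/-- **THE PIECE OF THE CUBE SET `U` IN THE POWER MEMBER `Tr Tᵐ`**: the sum, over the m-tuples of pieces that CHAIN (consecutive supports meet) and whose supports have union exactly `U`, of the
traces of the ordered products (pieces `T i` with supports `supp i`; at the record `ι` = the localization domains, `supp` = the underlying cube set). [cite: Balaban1985UV3, p.272 (after (63)); Balaban1987RG1, (1.7) p.261] -/
noncomputable def locPowPiece (m : ℕ) (U : Finset Q) : ℂ :=
  ∑ l ∈ (listsLen (S := ι) m).filter (fun l => List.IsChain (fun i j => ¬ Disjoint (supp i) (supp j)) l ∧ (l.map supp).foldr (· ∪ ·) ∅ = U),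
    Matrix.trace ((l.map T).prod)

variable {supp T}

/-- ★★ **THE LOCALIZED POWER EXPANSION**: `Tr (Σ_i T_i)ᵐ = Σ_U locPowPiece supp T m U` — every tuple is attached to the union of its supports, and non-chaining tuples vanish.
[cite: Balaban1985UV3, (63) p.272 («Tr Tⁿ … analyzed in the same way»); Balaban1987RG1, (1.7) p.261] -/
theorem trace_pow_eq_sum_locPowPiece (hT : ∀ i s s', (cube s ∉ supp i ∨ cube s' ∉ supp i) → T i s s' = 0) (m : ℕ) :
    Matrix.trace ((∑ i, T i) ^ m) = ∑ U : Finset Q, locPowPiece supp T m U := by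
  rw [sum_pow_eq_sum_listsLen T m, Matrix.trace_sum]
  -- the condition attaching a list to a cube set
  let cond : List ι → Finset Q → Prop := fun l U => List.IsChain (fun i j => ¬ Disjoint (supp i) (supp j)) l ∧ (l.map supp).foldr (· ∪ ·) ∅ = U
  -- (1) per list: its trace is the sum over `U` of the attached indicator
  have key : ∀ l ∈ listsLen (S := ι) m, Matrix.trace ((l.map T).prod) = ∑ U : Finset Q, (if cond l U then Matrix.trace ((l.map T).prod) else 0) := by
    intro l _
    by_cases hch : List.IsChain (fun i j => ¬ Disjoint (supp i) (supp j)) l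
    · rw [Finset.sum_eq_single ((l.map supp).foldr (· ∪ ·) ∅)]
      · rw [if_pos ⟨hch, rfl⟩]
      · intro U _ hU
        rw [if_neg]
        rintro ⟨_, hU'⟩
        exact hU hU'.symm
      · intro h; exact (h (mem_univ _)).elim
    · rw [prod_map_eq_zero_of_not_isChain supp T hT l hch, Matrix.trace_zero]
      refine (sum_eq_zero fun U _ => ?_).symm
      rw [if_neg fun h => hch h.1]
  -- (2) swap the sums
  calc ∑ l ∈ listsLen (S := ι) m, Matrix.trace ((l.map T).prod)
      = ∑ l ∈ listsLen (S := ι) m, ∑ U : Finset Q, (if cond l U then Matrix.trace ((l.map T).prod) else 0) := sum_congr rfl key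
    _ = ∑ U : Finset Q, ∑ l ∈ listsLen (S := ι) m, (if cond l U then Matrix.trace ((l.map T).prod) else 0) := Finset.sum_comm
    _ = ∑ U : Finset Q, locPowPiece supp T m U := by
        refine sum_congr rfl fun U _ => ?_
        rw [locPowPiece, sum_filter]

omit [Fintype Q] in
/-- ★ **THE DETERMINISTIC BOUND ON A PIECE**: for `m ≥ 1`, `‖locPowPiece supp T m U‖ ≤ N_U · Σ_{chains ↦ U} Π ‖T_i‖`, `N_U = #{s : cube s ∈ U}` (the product of a chain with union `U` is
supported in `U`).  The polymer bound on the right-hand side (via (2.27) and the `K₀`-sums) is PART B. [cite: Balaban1985UV3, (23) p.262, p.272; Balaban1988RG2Cluster, (2.27) p.18] -/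
theorem norm_locPowPiece_le (hT : ∀ i s s', (cube s ∉ supp i ∨ cube s' ∉ supp i) → T i s s' = 0) {m : ℕ} (hm : 1 ≤ m) (U : Finset Q) :
    ‖locPowPiece supp T m U‖ ≤ ((univ.filter fun s : S => cube s ∈ U).card : ℝ) *
      ∑ l ∈ (listsLen (S := ι) m).filter (fun l => List.IsChain (fun i j => ¬ Disjoint (supp i) (supp j)) l ∧ (l.map supp).foldr (· ∪ ·) ∅ = U),
        (l.map fun i => ‖T i‖).prod := by
  unfold locPowPiece
  rw [mul_sum]
  refine (norm_sum_le _ _).trans (sum_le_sum fun l hl => ?_)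
  obtain ⟨hl, _, hU⟩ := mem_filter.1 hl
  have hlen : l.length = m := (mem_listsLen_iff m l).1 hl
  have hne : l ≠ [] := by rintro rfl; simp at hlen; omega
  have hsupp : ∀ s s', (cube s ∉ U ∨ cube s' ∉ U) → (l.map T).prod s s' = 0 := by
    rw [← hU]
    exact supported_prod_map supp T hT _ hne
  exact (norm_trace_le_of_supported hsupp).trans (mul_le_mul_of_nonneg_left (norm_prod_map_le T l hne) (by positivity))

end Regroup

/-! ## §6  On the torus: the pieces live on localization domains -/

section TorusPieces

variable {d N : ℕ} {S : Type} [Fintype S] [DecidableEq S] {ι : Type} [Fintype ι] [DecidableEq ι] {supp : ι → Finset (TPt d N)} {T : ι → Matrix S S ℂ}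

/-- ★ **ONLY LOCALIZATION DOMAINS CARRY PIECES**: if every support is a torus localization domain and `m ≥ 1`, the piece of a cube set that is NOT a domain vanishes (every chaining tuple has a
domain as union, §3) — so `Tr Tᵐ = Σ_{X ∈ 𝐃} locPowPiece … X.1`. [cite: Balaban1987RG1, p.257 (localization domains), (1.7) p.261; Balaban1988RG2Cluster, (2.27) p.18] -/
theorem locPowPiece_eq_zero_of_not_isTDom (hsupp : ∀ i, IsTDom (supp i)) {m : ℕ} (hm : 1 ≤ m) {U : Finset (TPt d N)} (hU : ¬ IsTDom U) :
    locPowPiece supp T m U = 0 := by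
  unfold locPowPiece
  refine sum_eq_zero fun l hl => ?_
  obtain ⟨hl, hch, hlU⟩ := mem_filter.1 hl
  have hlen : l.length = m := (mem_listsLen_iff m l).1 hl
  have hne : l ≠ [] := by rintro rfl; simp at hlen; omega
  exact (hU (hlU ▸ isTDom_union_of_isChain supp hsupp l hne hch)).elim

end TorusPieces

end Summit.QuantumFields.YangMills.Theorems.BalabanUVNodesPortS1
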